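import Summits.BirchSwinnertonDyer.Rank1Residual.X11b.KummerLocalIndex
import Summits.BirchSwinnertonDyer.Rank1Residual.Additive.StrictSelmerIndexLocal
import Mathlib.GroupTheory.OrderOfElement
import HarnessLib

/-!
# The LOCAL half of input (ii) of the finite-level count (C): `ord loc_v κ_{p^m}(P) = p^{m−ν}` where
# `ν` is the exact `p`-divisibility level of `P` in `E(K_v)` (no `p`-torsion in `E(K_v)`) — the `ν` of
# gen 30's `#Sel_str(E/ℚ)[p^∞] = p^ν · #Ш(E/ℚ)[p^∞]` (cell `b2b-bsdres`, CLASS-CLOSURE lane, class O10 —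
# x1b GEN 37, class lead; file 67 of the series)

HONEST FRAMING (cell `b2b-bsdres`, run/shared/lean/b2b/bsd-rank1-residual/, verbatim in every
file): the goal of the cell is to DELETE the COMBINATION-SHAPED residual classes of the
Birch–Swinnerton-Dyer formula for ALL analytic-rank `≤ 1` elliptic curves over `ℚ` — "full BSD
formula for every rank `≤ 1` curve in class `C`" assembled STRICTLY from published theorems — so
that the rank-`≤ 1` remainder becomes exactly the CONSTRUCTION-SHAPED classes, which are TYPED
(missing-input `Prop`s), NOT attempted. This is not "finishing BSD". CLASS-CLOSURE lane: prove
what is provable now; shrink each hard class to its core with data; no claim beyond stated classes;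
research routes on CONSTRUCTION-SHAPED X12 / O10; census / instrument output = EVIDENCE / conjecture
items, NEVER a Literature fact; `RESIDUAL-MAP.md` marks change only by signed lines. THIS FILE:
TOOL THEOREMS ONLY — no definition, no named Literature fact, no Summits-side fact `def … : Prop`,
no `sorry`, axioms standard; the local inputs (`E(K_v)` has no `p`-torsion; `P` has exact
`p`-divisibility level `ν` in `E(K_v)`) are HYPOTHESES; nothing is booked; no label / mark / count /
sub-cell moves; (C1_η), (C2_η-GZ), (C3_η) stay typed as filed (cc-typer-6's pen); O10 stays OPEN /
CONSTRUCTION-SHAPED; nothing about `BSD(W, p)` of any pair is claimed.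

## What (x1b GEN 37 file 63 `DefectCountFiniteLevel`, input (ii), local half)

* **`addOrderOf_localKummerMap_eq`** — for a `K`-field `E` of characteristic `0`, `n = p^m`, an
  `E`-rational point `P` of `W⁄E` with `P = p^ν·Q`, `P ∉ p^{ν+1}·(W⁄E)(E)` and no `p`-torsion in
  `(W⁄E)(E)`, `ν ≤ m`: **`ord κ_{E,p^m}(P) = p^{m−ν}`** (the local Kummer map has kernel `p^m·(W⁄E)(E)`,
  Literature `ker_localKummerMap`; the class of `P` in `(W⁄E)(E)/p^m` has order `p^{m−ν}`).
* **`addOrderOf_localization_kummerMapTorsion_eq`** — over a number field `K`, at a place `v` whose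
  completion has characteristic `0`: **`ord loc_v κ_{p^m}(P) = p^{m−ν}`** for `P ∈ E(K)` whose base
  change to `K_v` has exact level `ν` (X11b `res_kummerMapTorsion_eq_localKummerMap`:
  `loc_v κ(P) = κ_{K_v}(P_{K_v})`).  With gen 30's `ν` (`StrictSelmerIndex`: the `p`-divisibility
  level of the generator in `E(ℚ_p)`) this is exactly input (ii)'s `ord loc_p κ_m(P) = p^{m−ν}`.

References: [SilvermanAEC2009] VIII.§2, X.§4 (diagram (**)), Prop. VII.6.3; [GreenbergLNM1716] §2
(pp. 62–63); [KuriharaPollack2007] §1.5 (the index of the generator).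
-/

noncomputable section

open scoped Classical

universe u

open WeierstrassCurve Literature.NumberTheory.EllipticCurves Literature.NumberTheory.GaloisRepresentations
open NumberField IsDedekindDomain

namespace Summit.BirchSwinnertonDyer.Rank1Residual.Additive.LocalKummerOrder

/-! ## §1. The order of a local Kummer class -/

section Local

variable {K : Type u} [Field K] [CharZero K] (W : WeierstrassCurve K) [W.IsElliptic]
  (E : Type u) [Field E] [Algebra K E] [CharZero E]

/-- **`ord κ_{E,p^m}(P) = p^{m−ν}`** for an `E`-rational point `P = p^ν·Q` of exact `p`-divisibility
level `ν` (no `P = p^{ν+1}·Q'`) in a group `(W⁄E)(E)` without `p`-torsion, `ν ≤ m`: `a · κ(P) = 0 ↔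
a·P ∈ p^m·(W⁄E)(E)` (Literature `ker_localKummerMap`), and `p^{m−ν−1} P = p^{m−1} Q ∈ p^m (W⁄E)(E)`
would force `Q ∈ p·(W⁄E)(E)` (no `p`-power torsion). [cite: SilvermanAEC2009, §VIII.2 (Kummer sequence)]
[cite: GreenbergLNM1716, §2 (pp. 62–63)] -/
theorem addOrderOf_localKummerMap_eq {p : ℕ} [hp : Fact p.Prime] {m ν : ℕ} (hνm : ν ≤ m)
    (htors : ∀ X : (W.baseChange E).toAffine.Point, p • X = 0 → X = 0)
    {P Q : (W.baseChange E).toAffine.Point} (hPQ : p ^ ν • Q = P)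
    (hexact : ∀ Q' : (W.baseChange E).toAffine.Point, p ^ (ν + 1) • Q' ≠ P) :
    addOrderOf (W.localKummerMap E
      (show (((p ^ m : ℕ) : ℤ)) ≠ 0 by exact_mod_cast pow_ne_zero m hp.out.ne_zero) P) =
      p ^ (m - ν) := by
  set hn : (((p ^ m : ℕ) : ℤ)) ≠ 0 := by exact_mod_cast pow_ne_zero m hp.out.ne_zero
  have hker := W.ker_localKummerMap E hn
  -- `a • κ(P) = 0 ↔ a • P ∈ p^m (W⁄E)(E)`
  have hiff : ∀ a : ℕ, a • W.localKummerMap E hn P = 0 ↔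
      ∃ R : (W.baseChange E).toAffine.Point, ((p ^ m : ℕ) : ℤ) • R = a • P := fun a => by
    rw [← map_nsmul, ← AddMonoidHom.mem_ker, hker]
    rfl
  rcases Nat.eq_or_lt_of_le hνm with hνeq | hνlt
  · -- `ν = m`: `κ(P) = κ(p^m Q) = 0`
    subst hνeq
    rw [Nat.sub_self, pow_zero, AddMonoid.addOrderOf_eq_one_iff, ← one_nsmul (W.localKummerMap E hn P), hiff]
    exact ⟨Q, by rw [one_nsmul, ← hPQ, natCast_zsmul]⟩
  · obtain ⟨d, hd⟩ : ∃ d, m - ν = d + 1 := ⟨m - ν - 1, by omega⟩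
    rw [hd]
    refine addOrderOf_eq_prime_pow (fun h => ?_) ?_
    · -- `p^d • κ(P) = 0` ⟹ `p^d P = p^m R` ⟹ `p^{m-1}(Q - pR) = 0` ⟹ `Q = pR`: contradiction
      obtain ⟨R, hR⟩ := (hiff (p ^ d)).mp h
      rw [natCast_zsmul, ← hPQ, ← mul_nsmul', ← pow_add] at hR
      have hm : m = (d + ν) + 1 := by omega
      rw [hm, pow_succ, mul_nsmul'] at hR
      -- `hR : p^(d+ν) • (p • R) = p^(d+ν) • Q`
      have hzero : p ^ (d + ν) • (p • R - Q) = 0 := by rw [nsmul_sub, hR, sub_self]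
      have hQ : Q = p • R := (sub_eq_zero.mp (StrictSha.eq_zero_of_pow_nsmul_eq_zero htors hzero)).symm
      exact hexact R (by rw [pow_succ, mul_nsmul', ← hQ, hPQ])
    · rw [hiff]
      refine ⟨Q, ?_⟩
      rw [natCast_zsmul, ← hPQ, ← mul_nsmul', ← pow_add, show d + 1 + ν = m by omega]

end Local

/-! ## §2. Over a number field: the order of `loc_v κ_{p^m}(P)` -/

section Global

variable {K : Type u} [Field K] [NumberField K] (W : WeierstrassCurve K) [W.IsElliptic]

/-- **`ord loc_v κ_{p^m}(P) = p^{m−ν}`** at a place `v` (completion of characteristic `0`) for a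
rational point `P ∈ E(K)` whose base change `P_v ∈ (W⁄K_v)(K_v)` has exact `p`-divisibility level
`ν ≤ m` in a group without `p`-torsion: localisation of the global Kummer map is the local Kummer map
of the base-changed point (X11b `KummerIndex.res_kummerMapTorsion_eq_localKummerMap`), then §1.
Input (ii), local half, of file 63; `ν` is gen 30's divisibility level (`StrictSelmerIndex`).
[cite: SilvermanAEC2009, X.§4 diagram (**)] [cite: GreenbergLNM1716, §2 (pp. 62–63)] -/
theorem addOrderOf_localization_kummerMapTorsion_eq {p : ℕ} [hp : Fact p.Prime] {m ν : ℕ}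
    (hνm : ν ≤ m) (hdiv : ∀ P : geomPoints W, ∃ Q : geomPoints W, ((p ^ m : ℕ) : ℤ) • Q = P)
    (v : Place K) [CharZero (Place.Completion v)]
    (htors : ∀ X : (W.baseChange (Place.Completion v)).toAffine.Point, p • X = 0 → X = 0)
    (P : W.toAffine.Point) {Q : (W.baseChange (Place.Completion v)).toAffine.Point}
    (hPQ : p ^ ν • Q = Affine.Point.baseChange (W' := W) K (Place.Completion v) P)
    (hexact : ∀ Q' : (W.baseChange (Place.Completion v)).toAffine.Point,
      p ^ (ν + 1) • Q' ≠ Affine.Point.baseChange (W' := W) K (Place.Completion v) P) :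
    addOrderOf (galoisCohomology.localization (W.torsionGaloisModule ((p ^ m : ℕ) : ℤ)) v 1
      (kummerMapTorsion W ((p ^ m : ℕ) : ℤ) hdiv P)) = p ^ (m - ν) := by
  have hn : (((p ^ m : ℕ) : ℤ)) ≠ 0 := by exact_mod_cast pow_ne_zero m hp.out.ne_zero
  have h := X11b.KummerIndex.res_kummerMapTorsion_eq_localKummerMap W (Place.Completion v) hn hdiv P
  change addOrderOf (galoisCohomology.res (W.torsionGaloisModule ((p ^ m : ℕ) : ℤ))
    (Place.Completion v) 1 (kummerMapTorsion W ((p ^ m : ℕ) : ℤ) hdiv P)) = p ^ (m - ν)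
  rw [h]
  exact addOrderOf_localKummerMap_eq W (Place.Completion v) hνm htors hPQ hexact

end Global

end Summit.BirchSwinnertonDyer.Rank1Residual.Additive.LocalKummerOrder

end
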